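import Summits.QuantumFields.BalabanUV.Beta.GAN24.SlotDefectWindowBound

/-!
# `BalabanUV.Beta.GAN24.SlotDefectWindowShapes` — binder row G-an2-4 ∕ (CONV-C), CT-W, route of record «WC-TL» (RULING R-gan24p1-g24-1 ∕ -2,
# `gen24/CT-W-DESIGN-v2.md` v2.1 §3 row (Q): `LocStencil₂ (q_j)` member-free), PART 2 of the journal INTENT [LEAF02-G53-ONLINE] «ι-WIN»:
# **A DECAY CLASS ON A SLAVED SOURCE-SLOT DIVERGENCE TRANSFERS TO THE ONE-SLOT DRESSING DEFECT — `LocStencil₂` COROLLARIES OF THE WINDOW BOUNDS**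
# (first source slot: constant `2(d+1)N · (2N+1)^{d+1} · e^{3δ(d+1)N} · C`; second source slot: `2(d+1)N · (2N+1)^{d+1} · e^{δ(d+1)N} · C`; same rate `δ`)

NOT IN PRINT; OUR BOOKKEEPING (G-an2-4 crux team (2), leaf prover `b2b-balaban-gan24-formalise-leaf-02`, gen 53).  [folklore] recentring of exponential weights over
the window `[−N, N]^{d+1}` (`AxialDressingRooted.l1_le_of_mem_cube`, `ExpKernelCalculus.l1_sub_triangle`, `card_cube`) on top of PART 1
`SlotDefectWindowBound.abs_coProj_fst_sub_self_le ∕ abs_coProj_snd_sub_self_le`; generic `d + 1`, in-block root, `1 ≤ N`; the divergence-decay hypotheses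
are DISPLAYED INLINE as letters (no new class, 0 `def`, 0 cited facts, 0 `def … : Prop`, 0 sorry) — they are what SLAVE-src (`T2SlavedDivergence`: the member's
source-slot divergences one level up are level-`j` FIRST-ORDER data) composed with the (Q-S) ∕ (Q-R) rows is to deliver, uniformly in `j`; this file turns such a
delivery into the `LocStencil₂` INPUT SHAPE of road W3's transport rows for the two `|S| = 1` source terms of `(𝔇 − 1) T̃_j`.
HONEST FRAMING (cell contract, verbatim): «discharging `BetaPertH` makes Bałaban's UV stability UNCONDITIONAL — a real constructive-QFT result; it is NOT the
continuum limit and NOT the Clay problem.»  HONEST DEPENDENCY (verbatim): «continuum YM on T⁴ ⇐ BetaPertH ∧ nine spine estimates (0/9 proved); BetaPertH ⇐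
(D1) ∧ (D4) ∧ CAP+tail; G-an2-4 gates asym, D1 and NE2/3/4.»

## What (`ρ = toSite r`, `r ∈ box (d+1) N`, `1 ≤ N`, `0 ≤ δ`)
* §1 `exp_window_recenter_le` — `v ∈ cube (d+1) N ⇒ e^{−δ|w − (u+v)|₁} ≤ e^{δ(d+1)N} · e^{−δ|w − u|₁}`; `exp_window_recenter_le'` — `e^{−δ|(u′+v) − u|₁} ≤ e^{δ(d+1)N} · e^{−δ|u′ − u|₁}`;
  `sum_cube_const` (`Σ_{v ∈ cube} c = (2N+1)^{d+1} · c`).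
* §2 **`locStencil₂_coProj_fst_sub_self_of_div`** — if the FIRST-slot divergence table is localised at its own site,
  `|(divV (κ₁ u₁ ↦ Y κ₁ u₁ κ′ u′) p) x z a b| ≤ C · e^{−δ|u′ − p|₁} · e^{−δ(|x − p|₁ + |z − p|₁)}` for all `p κ′ u′ x z a b`, then
  `LocStencil₂ (P₁ Y − Y) (2(d+1)N · (2N+1)^{d+1} · e^{3δ(d+1)N} · C) δ`.
* §3 **`locStencil₂_coProj_snd_sub_self_of_div`** — if the SECOND-slot divergence table is localised at the first slot's site,
  `|(divV (κ₁ u₁ ↦ X κ u κ₁ u₁) p) x z a b| ≤ C · e^{−δ|p − u|₁} · e^{−δ(|x − u|₁ + |z − u|₁)}` for all `κ u p x z a b`, then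
  `LocStencil₂ (P₂ X − X) (2(d+1)N · (2N+1)^{d+1} · e^{δ(d+1)N} · C) δ`.
* §4 **`locStencil₂_defect_fst_snd_of_div₂`** — the `|S| = 2` source nest: if the DOUBLE slot divergence is localised at the first-slot site,
  `|(divV (κ₂ u₂ ↦ divV (κ₁ u₁ ↦ Y κ₁ u₁ κ₂ u₂) p) p′) x z a b| ≤ C · e^{−δ|p′ − p|₁} · e^{−δ(|x − p|₁ + |z − p|₁)}` for all `p p′ x z a b`, then
  `LocStencil₂ (P₁ (P₂ Y − Y) − (P₂ Y − Y)) ((2(d+1)N)² · (2N+1)^{2(d+1)} · e^{4δ(d+1)N} · C) δ` (PART 1 `abs_defect_fst_snd_le`, two recentrings).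
* §5 `locStencil₂_add₃` and **`locStencil₂_sourceDefects_of_div`** — THE THREE PURE-SOURCE TERMS OF T-DL TOGETHER: under the three letters of §2–§4 (constants
  `C₁ C₂ C₁₂`, one rate `δ`), `LocStencil₂ (D_{2} Y + D_{1} Y + D_{2,1} Y) (κ₂·C₂ + κ₁·C₁ + κ₁₂·C₁₂) δ` with the displayed window constants — the `S ⊆ {1,2}` part of
  row (Q-D) («WC-TL» §3; leaf-01 g63's `T2DevConservationDefectRows` letter) in ONE line for its END.
* §6 DOCKING WITH (Q-R)'s OUTPUT CONVENTION (the row owner's `gen25/QR-DESIGN-v0.md` §0: the slaved first-slot divergence comes out of the S-step bi-localised at the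
  REMAINING slot `u′` in the legs, with a separate label rate in `|u′ − p|₁`): `letter_fst_recenter` — a two-rate, output-centred letter
  `|(divV (κ₁ u₁ ↦ Y κ₁ u₁ κ′ u′) p) x z a b| ≤ C·e^{−δ′|u′ − p|₁}·e^{−δ(|x − u′|₁ + |z − u′|₁)}` implies the site-centred letter of §2 at any rate `δ₀` with
  `0 ≤ δ₀ ≤ δ`, `3δ₀ ≤ δ′`; **`locStencil₂_coProj_fst_sub_self_of_div'`** — the §2 corollary stated directly on the output-centred letter.
Asserts NO value of any divergence of Bałaban's tables; the hypotheses are LETTERS (nothing of SLAVE-src ∕ (Q-S) ∕ (Q-R) is proved here); discharges NOTHING of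
(H) ∕ (Q) ∕ «T2Shape» ∕ «T2Drift» ∕ (hW, hWall); 0 wall binders; NEVER «G-an2-4 closed» as (CONV-C); NOT D1, NOT `BetaPertH`, NOT continuum, NOT Clay; not in print —
our bookkeeping.  Unit `b2b-balaban-gan24-formalise-leaf-02` (gen 53), 2026-08-22.
-/

noncomputable section

open Finset
open scoped BigOperators
open Literature.MathematicalPhysics.QuantumFieldTheory
open Literature.MathematicalPhysics.QuantumFieldTheory.Balaban1983to89
open Literature.MathematicalPhysics.QuantumFieldTheory.Balaban1983to89.Beta
open B12Sec2to5 (l1 l1_nonneg)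
open ExpKernelCalculus (MKer Site l1_sub_triangle l1_sub_symm)
open AffineAveraging (Form0 Form1 box toSite unitVec)
open OneStepResolventKernel (Fib)
open KernelWard (divV)
open BalabanCompositeJets (LocStencil₂)
open Summit.QuantumFields.BalabanUV.Beta.AxialDressingRooted (cube mem_cube card_cube l1_le_of_mem_cube coProjBmAtK)
open Summit.QuantumFields.BalabanUV.Beta.GAN24.BiStencilZeroMode (Tab)
open Summit.QuantumFields.BalabanUV.Beta.GAN24.SlotDefectWindowBound (abs_coProj_fst_sub_self_le abs_coProj_snd_sub_self_le abs_defect_fst_snd_le two_mul_nonneg)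

namespace Summit.QuantumFields.BalabanUV.Beta.GAN24.SlotDefectWindowShapes

variable {d : ℕ}

/-! ## §1 Recentring exponential weights over the window -/

/-- [folklore] **RECENTRING OVER THE WINDOW**: for `v ∈ [−N, N]^{d+1}` and `δ ≥ 0`, `e^{−δ|w − (u+v)|₁} ≤ e^{δ(d+1)N} · e^{−δ|w − u|₁}`. -/
theorem exp_window_recenter_le {N : ℕ} {v : Fin (d + 1) → ℤ} (hv : v ∈ cube (d + 1) N) {δ : ℝ} (hδ : 0 ≤ δ) (w u : Fin (d + 1) → ℤ) :
    Real.exp (-δ * l1 (w - (u + v))) ≤ Real.exp (δ * (((d : ℝ) + 1) * N)) * Real.exp (-δ * l1 (w - u)) := by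
  have h1 : l1 (w - u) ≤ l1 (w - (u + v)) + l1 ((u + v) - u) := l1_sub_triangle w (u + v) u
  have h2 : l1 ((u + v) - u) ≤ ((d : ℝ) + 1) * N := by
    rw [add_sub_cancel_left]
    have h := l1_le_of_mem_cube hv
    push_cast at h
    exact h
  rw [← Real.exp_add]
  exact Real.exp_le_exp.2 (by nlinarith)

/-- [folklore] The same for a window shift of the moving point: `e^{−δ|(u′+v) − u|₁} ≤ e^{δ(d+1)N} · e^{−δ|u′ − u|₁}`. -/
theorem exp_window_recenter_le' {N : ℕ} {v : Fin (d + 1) → ℤ} (hv : v ∈ cube (d + 1) N) {δ : ℝ} (hδ : 0 ≤ δ) (u' u : Fin (d + 1) → ℤ) :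
    Real.exp (-δ * l1 ((u' + v) - u)) ≤ Real.exp (δ * (((d : ℝ) + 1) * N)) * Real.exp (-δ * l1 (u' - u)) := by
  have h1 : l1 (u' - u) ≤ l1 (u' - (u' + v)) + l1 ((u' + v) - u) := l1_sub_triangle u' (u' + v) u
  have h2 : l1 (u' - (u' + v)) ≤ ((d : ℝ) + 1) * N := by
    rw [l1_sub_symm, add_sub_cancel_left]
    have h := l1_le_of_mem_cube hv
    push_cast at h
    exact h
  rw [← Real.exp_add]
  exact Real.exp_le_exp.2 (by nlinarith)

/-- [folklore] `Σ_{v ∈ cube (d+1) N} c = (2N+1)^{d+1} · c`. -/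
theorem sum_cube_const (N : ℕ) (c : ℝ) : ∑ _v ∈ cube (d + 1) N, c = (((2 * N + 1) ^ (d + 1) : ℕ) : ℝ) * c := by
  rw [Finset.sum_const, card_cube, nsmul_eq_mul]

/-! ## §2 First source slot: divergence decay ⟹ defect `LocStencil₂` -/

section Fst

variable {N : ℕ} {r : Fin (d + 1) → ℕ}

/-- NOT IN PRINT; OUR BOOKKEEPING.  **A FIRST-SLOT DIVERGENCE TABLE LOCALISED AT ITS OWN SITE GIVES A `LocStencil₂` FIRST-SLOT DEFECT** (in-block root, `1 ≤ N`,
`0 ≤ δ`; the hypothesis is a LETTER — the shape SLAVE-src ∘ (Q-S)∕(Q-R) is to deliver for `Y = T̃_j`, uniformly in `j`):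
if `|(divV (κ₁ u₁ ↦ Y κ₁ u₁ κ′ u′) p) x z a b| ≤ C·e^{−δ|u′ − p|₁}·e^{−δ(|x − p|₁ + |z − p|₁)}` for all `p κ′ u′ x z a b`, then
`LocStencil₂ (P₁ Y − Y) (2(d+1)N · (2N+1)^{d+1} · e^{3δ(d+1)N} · C) δ`, `P₁ Y := fun κ u κ′ u′ ↦ coProjBmAtK ρ N (κ₁ u₁ ↦ Y κ₁ u₁ κ′ u′) κ u`. -/
theorem locStencil₂_coProj_fst_sub_self_of_div (hN : 1 ≤ N) (hr : r ∈ box (d + 1) N) (Y : Tab d) {C δ : ℝ} (hδ : 0 ≤ δ)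
    (hW : ∀ (p : Fin (d + 1) → ℤ) (κ' : Fin (d + 1)) (u' x z : Fin (d + 1) → ℤ) (a b : Fib d),
      |divV (fun κ₁ u₁ => Y κ₁ u₁ κ' u') p x z a b| ≤ C * Real.exp (-δ * l1 (u' - p)) * Real.exp (-δ * (l1 (x - p) + l1 (z - p)))) :
    LocStencil₂ ((fun κ u κ' u' => coProjBmAtK (toSite r) N (fun κ₁ u₁ => Y κ₁ u₁ κ' u') κ u) - Y)
      (2 * ((d : ℝ) + 1) * N * ((((2 * N + 1) ^ (d + 1) : ℕ) : ℝ) * (Real.exp (3 * δ * (((d : ℝ) + 1) * N)) * C))) δ := by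
  have hC : 0 ≤ C := by
    have h := hW 0 0 0 0 0 (Sum.inl 0) (Sum.inl 0)
    have hpos : 0 < Real.exp (-δ * l1 ((0 : Fin (d + 1) → ℤ) - 0)) * Real.exp (-δ * (l1 ((0 : Fin (d + 1) → ℤ) - 0) + l1 ((0 : Fin (d + 1) → ℤ) - 0))) :=
      mul_pos (Real.exp_pos _) (Real.exp_pos _)
    have h' : 0 ≤ C * (Real.exp (-δ * l1 ((0 : Fin (d + 1) → ℤ) - 0)) * Real.exp (-δ * (l1 ((0 : Fin (d + 1) → ℤ) - 0) + l1 ((0 : Fin (d + 1) → ℤ) - 0)))) := by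
      rw [← mul_assoc]; exact (abs_nonneg _).trans h
    exact nonneg_of_mul_nonneg_left h' hpos
  intro κ u κ' u' x z a b
  set E : ℝ := Real.exp (δ * (((d : ℝ) + 1) * N)) with hE
  have hE3 : Real.exp (3 * δ * (((d : ℝ) + 1) * N)) = E * E * E := by
    rw [hE, ← Real.exp_add, ← Real.exp_add]; congr 1; ring
  -- each window term, recentred at `u`
  have hterm : ∀ v ∈ cube (d + 1) N, |divV (fun κ₁ u₁ => Y κ₁ u₁ κ' u') (u + v) x z a b|
      ≤ E * E * E * C * (Real.exp (-δ * l1 (u' - u)) * Real.exp (-δ * (l1 (x - u) + l1 (z - u)))) := by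
    intro v hv
    have h := hW (u + v) κ' u' x z a b
    have r1 := exp_window_recenter_le hv hδ u' u
    have r2 := exp_window_recenter_le hv hδ x u
    have r3 := exp_window_recenter_le hv hδ z u
    have split : Real.exp (-δ * (l1 (x - (u + v)) + l1 (z - (u + v)))) = Real.exp (-δ * l1 (x - (u + v))) * Real.exp (-δ * l1 (z - (u + v))) := by
      rw [← Real.exp_add]; congr 1; ring
    have split' : Real.exp (-δ * (l1 (x - u) + l1 (z - u))) = Real.exp (-δ * l1 (x - u)) * Real.exp (-δ * l1 (z - u)) := by
      rw [← Real.exp_add]; congr 1; ring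
    rw [split] at h
    rw [split']
    have hxz : Real.exp (-δ * l1 (x - (u + v))) * Real.exp (-δ * l1 (z - (u + v)))
        ≤ (E * Real.exp (-δ * l1 (x - u))) * (E * Real.exp (-δ * l1 (z - u))) :=
      mul_le_mul r2 r3 (Real.exp_pos _).le (mul_nonneg (Real.exp_pos _).le (Real.exp_pos _).le)
    calc |divV (fun κ₁ u₁ => Y κ₁ u₁ κ' u') (u + v) x z a b|
        ≤ C * Real.exp (-δ * l1 (u' - (u + v))) * (Real.exp (-δ * l1 (x - (u + v))) * Real.exp (-δ * l1 (z - (u + v)))) := h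
      _ ≤ C * (E * Real.exp (-δ * l1 (u' - u))) * ((E * Real.exp (-δ * l1 (x - u))) * (E * Real.exp (-δ * l1 (z - u)))) := by
          refine mul_le_mul (mul_le_mul_of_nonneg_left r1 hC) hxz (mul_nonneg (Real.exp_pos _).le (Real.exp_pos _).le) ?_
          exact mul_nonneg hC (mul_nonneg (Real.exp_pos _).le (Real.exp_pos _).le)
      _ = E * E * E * C * (Real.exp (-δ * l1 (u' - u)) * (Real.exp (-δ * l1 (x - u)) * Real.exp (-δ * l1 (z - u)))) := by ring
  have h1 := abs_coProj_fst_sub_self_le hN hr Y κ u κ' u' x z a b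
  show |((fun κ u κ' u' => coProjBmAtK (toSite r) N (fun κ₁ u₁ => Y κ₁ u₁ κ' u') κ u) - Y) κ u κ' u' x z a b| ≤ _
  refine h1.trans ?_
  calc 2 * ((d : ℝ) + 1) * N * ∑ v ∈ cube (d + 1) N, |divV (fun κ₁ u₁ => Y κ₁ u₁ κ' u') (u + v) x z a b|
      ≤ 2 * ((d : ℝ) + 1) * N * ∑ _v ∈ cube (d + 1) N, E * E * E * C * (Real.exp (-δ * l1 (u' - u)) * Real.exp (-δ * (l1 (x - u) + l1 (z - u)))) :=
        mul_le_mul_of_nonneg_left (Finset.sum_le_sum hterm) (two_mul_nonneg d N)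
    _ = _ := by rw [sum_cube_const, hE3]; ring

end Fst

/-! ## §3 Second source slot: divergence decay ⟹ defect `LocStencil₂` -/

section Snd

variable {N : ℕ} {r : Fin (d + 1) → ℕ}

/-- NOT IN PRINT; OUR BOOKKEEPING.  **A SECOND-SLOT DIVERGENCE TABLE LOCALISED AT THE FIRST SLOT's SITE GIVES A `LocStencil₂` SECOND-SLOT DEFECT** (in-block root,
`1 ≤ N`, `0 ≤ δ`; the hypothesis is a LETTER): if `|(divV (κ₁ u₁ ↦ X κ u κ₁ u₁) p) x z a b| ≤ C·e^{−δ|p − u|₁}·e^{−δ(|x − u|₁ + |z − u|₁)}` for all `κ u p x z a b`,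
then `LocStencil₂ (P₂ X − X) (2(d+1)N · (2N+1)^{d+1} · e^{δ(d+1)N} · C) δ`, `P₂ X := fun κ u ↦ coProjBmAtK ρ N (X κ u)`. -/
theorem locStencil₂_coProj_snd_sub_self_of_div (hN : 1 ≤ N) (hr : r ∈ box (d + 1) N) (X : Tab d) {C δ : ℝ} (hδ : 0 ≤ δ)
    (hW : ∀ (κ : Fin (d + 1)) (u p x z : Fin (d + 1) → ℤ) (a b : Fib d),
      |divV (fun κ₁ u₁ => X κ u κ₁ u₁) p x z a b| ≤ C * Real.exp (-δ * l1 (p - u)) * Real.exp (-δ * (l1 (x - u) + l1 (z - u)))) :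
    LocStencil₂ ((fun κ u => coProjBmAtK (toSite r) N (X κ u)) - X)
      (2 * ((d : ℝ) + 1) * N * ((((2 * N + 1) ^ (d + 1) : ℕ) : ℝ) * (Real.exp (δ * (((d : ℝ) + 1) * N)) * C))) δ := by
  have hC : 0 ≤ C := by
    have h := hW 0 0 0 0 0 (Sum.inl 0) (Sum.inl 0)
    have hpos : 0 < Real.exp (-δ * l1 ((0 : Fin (d + 1) → ℤ) - 0)) * Real.exp (-δ * (l1 ((0 : Fin (d + 1) → ℤ) - 0) + l1 ((0 : Fin (d + 1) → ℤ) - 0))) :=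
      mul_pos (Real.exp_pos _) (Real.exp_pos _)
    have h' : 0 ≤ C * (Real.exp (-δ * l1 ((0 : Fin (d + 1) → ℤ) - 0)) * Real.exp (-δ * (l1 ((0 : Fin (d + 1) → ℤ) - 0) + l1 ((0 : Fin (d + 1) → ℤ) - 0)))) := by
      rw [← mul_assoc]; exact (abs_nonneg _).trans h
    exact nonneg_of_mul_nonneg_left h' hpos
  intro κ u κ' u' x z a b
  set E : ℝ := Real.exp (δ * (((d : ℝ) + 1) * N)) with hE
  have hterm : ∀ v ∈ cube (d + 1) N, |divV (fun κ₁ u₁ => X κ u κ₁ u₁) (u' + v) x z a b|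
      ≤ E * C * (Real.exp (-δ * l1 (u' - u)) * Real.exp (-δ * (l1 (x - u) + l1 (z - u)))) := by
    intro v hv
    have h := hW κ u (u' + v) x z a b
    have r1 := exp_window_recenter_le' hv hδ u' u
    calc |divV (fun κ₁ u₁ => X κ u κ₁ u₁) (u' + v) x z a b|
        ≤ C * Real.exp (-δ * l1 ((u' + v) - u)) * Real.exp (-δ * (l1 (x - u) + l1 (z - u))) := h
      _ ≤ C * (E * Real.exp (-δ * l1 (u' - u))) * Real.exp (-δ * (l1 (x - u) + l1 (z - u))) :=
          mul_le_mul_of_nonneg_right (mul_le_mul_of_nonneg_left r1 hC) (Real.exp_pos _).le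
      _ = E * C * (Real.exp (-δ * l1 (u' - u)) * Real.exp (-δ * (l1 (x - u) + l1 (z - u)))) := by ring
  have h1 := abs_coProj_snd_sub_self_le hN hr X κ u κ' u' x z a b
  show |((fun κ u => coProjBmAtK (toSite r) N (X κ u)) - X) κ u κ' u' x z a b| ≤ _
  refine h1.trans ?_
  calc 2 * ((d : ℝ) + 1) * N * ∑ v ∈ cube (d + 1) N, |divV (fun κ₁ u₁ => X κ u κ₁ u₁) (u' + v) x z a b|
      ≤ 2 * ((d : ℝ) + 1) * N * ∑ _v ∈ cube (d + 1) N, E * C * (Real.exp (-δ * l1 (u' - u)) * Real.exp (-δ * (l1 (x - u) + l1 (z - u)))) :=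
        mul_le_mul_of_nonneg_left (Finset.sum_le_sum hterm) (two_mul_nonneg d N)
    _ = _ := by rw [sum_cube_const]; ring

end Snd

/-! ## §4 The `|S| = 2` source nest: double-divergence decay ⟹ defect `LocStencil₂` -/

section FstSnd

variable {N : ℕ} {r : Fin (d + 1) → ℕ}

/-- NOT IN PRINT; OUR BOOKKEEPING.  **A DOUBLE SLOT-DIVERGENCE TABLE LOCALISED AT THE FIRST-SLOT SITE GIVES A `LocStencil₂` `|S| = 2` SOURCE NEST** (in-block root,
`1 ≤ N`, `0 ≤ δ`; the hypothesis is a LETTER — the second divergence of the slaved first divergence is leaf-03's `E3SlotDivergence.divV_e3OfK` applied to SLAVE-src):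
if `|(divV (κ₂ u₂ ↦ divV (κ₁ u₁ ↦ Y κ₁ u₁ κ₂ u₂) p) p′) x z a b| ≤ C·e^{−δ|p′ − p|₁}·e^{−δ(|x − p|₁ + |z − p|₁)}` for all `p p′ x z a b`, then, with
`P₂ Y := κ u ↦ coProjBmAtK ρ N (Y κ u)`, `Z := P₂ Y − Y`, `P₁ Z := κ u κ′ u′ ↦ coProjBmAtK ρ N (κ₁ u₁ ↦ Z κ₁ u₁ κ′ u′) κ u`:
`LocStencil₂ (P₁ Z − Z) ((2(d+1)N)² · (2N+1)^{d+1} · (2N+1)^{d+1} · e^{4δ(d+1)N} · C) δ`. -/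
theorem locStencil₂_defect_fst_snd_of_div₂ (hN : 1 ≤ N) (hr : r ∈ box (d + 1) N) (Y : Tab d) {C δ : ℝ} (hδ : 0 ≤ δ)
    (hW : ∀ (p p' x z : Fin (d + 1) → ℤ) (a b : Fib d),
      |divV (fun κ₂ u₂ => divV (fun κ₁ u₁ => Y κ₁ u₁ κ₂ u₂) p) p' x z a b| ≤ C * Real.exp (-δ * l1 (p' - p)) * Real.exp (-δ * (l1 (x - p) + l1 (z - p)))) :
    LocStencil₂ ((fun κ u κ' u' => coProjBmAtK (toSite r) N (fun κ₁ u₁ => ((fun κ u => coProjBmAtK (toSite r) N (Y κ u)) - Y) κ₁ u₁ κ' u') κ u)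
        - ((fun κ u => coProjBmAtK (toSite r) N (Y κ u)) - Y))
      ((2 * ((d : ℝ) + 1) * N) ^ 2 * ((((2 * N + 1) ^ (d + 1) : ℕ) : ℝ) * ((((2 * N + 1) ^ (d + 1) : ℕ) : ℝ)
        * (Real.exp (4 * δ * (((d : ℝ) + 1) * N)) * C)))) δ := by
  have hC : 0 ≤ C := by
    have h := hW 0 0 0 0 (Sum.inl 0) (Sum.inl 0)
    have hpos : 0 < Real.exp (-δ * l1 ((0 : Fin (d + 1) → ℤ) - 0)) * Real.exp (-δ * (l1 ((0 : Fin (d + 1) → ℤ) - 0) + l1 ((0 : Fin (d + 1) → ℤ) - 0))) :=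
      mul_pos (Real.exp_pos _) (Real.exp_pos _)
    have h' : 0 ≤ C * (Real.exp (-δ * l1 ((0 : Fin (d + 1) → ℤ) - 0)) * Real.exp (-δ * (l1 ((0 : Fin (d + 1) → ℤ) - 0) + l1 ((0 : Fin (d + 1) → ℤ) - 0)))) := by
      rw [← mul_assoc]; exact (abs_nonneg _).trans h
    exact nonneg_of_mul_nonneg_left h' hpos
  intro κ u κ' u' x z a b
  set E : ℝ := Real.exp (δ * (((d : ℝ) + 1) * N)) with hE
  have hE4 : Real.exp (4 * δ * (((d : ℝ) + 1) * N)) = E * E * E * E := by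
    rw [hE, ← Real.exp_add, ← Real.exp_add, ← Real.exp_add]; congr 1; ring
  -- each double-window term, recentred at `u`
  have hterm : ∀ v ∈ cube (d + 1) N, ∀ v' ∈ cube (d + 1) N,
      |divV (fun κ₂ u₂ => divV (fun κ₁ u₁ => Y κ₁ u₁ κ₂ u₂) (u + v)) (u' + v') x z a b|
        ≤ E * E * E * E * C * (Real.exp (-δ * l1 (u' - u)) * Real.exp (-δ * (l1 (x - u) + l1 (z - u)))) := by
    intro v hv v' hv'
    have h := hW (u + v) (u' + v') x z a b
    -- `|u′ − u| ≤ |u′+v′ − (u+v)| + 2(d+1)N`: two recentrings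
    have r1a := exp_window_recenter_le hv hδ (u' + v') u
    have r1b := exp_window_recenter_le' hv' hδ u' u
    have r1 : Real.exp (-δ * l1 ((u' + v') - (u + v))) ≤ E * E * Real.exp (-δ * l1 (u' - u)) := by
      calc Real.exp (-δ * l1 ((u' + v') - (u + v))) ≤ E * Real.exp (-δ * l1 ((u' + v') - u)) := r1a
        _ ≤ E * (E * Real.exp (-δ * l1 (u' - u))) := mul_le_mul_of_nonneg_left r1b (Real.exp_pos _).le
        _ = E * E * Real.exp (-δ * l1 (u' - u)) := by ring
    have r2 := exp_window_recenter_le hv hδ x u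
    have r3 := exp_window_recenter_le hv hδ z u
    have split : Real.exp (-δ * (l1 (x - (u + v)) + l1 (z - (u + v)))) = Real.exp (-δ * l1 (x - (u + v))) * Real.exp (-δ * l1 (z - (u + v))) := by
      rw [← Real.exp_add]; congr 1; ring
    have split' : Real.exp (-δ * (l1 (x - u) + l1 (z - u))) = Real.exp (-δ * l1 (x - u)) * Real.exp (-δ * l1 (z - u)) := by
      rw [← Real.exp_add]; congr 1; ring
    rw [split] at h
    rw [split']
    have hxz : Real.exp (-δ * l1 (x - (u + v))) * Real.exp (-δ * l1 (z - (u + v)))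
        ≤ (E * Real.exp (-δ * l1 (x - u))) * (E * Real.exp (-δ * l1 (z - u))) :=
      mul_le_mul r2 r3 (Real.exp_pos _).le (mul_nonneg (Real.exp_pos _).le (Real.exp_pos _).le)
    calc |divV (fun κ₂ u₂ => divV (fun κ₁ u₁ => Y κ₁ u₁ κ₂ u₂) (u + v)) (u' + v') x z a b|
        ≤ C * Real.exp (-δ * l1 ((u' + v') - (u + v))) * (Real.exp (-δ * l1 (x - (u + v))) * Real.exp (-δ * l1 (z - (u + v)))) := h
      _ ≤ C * (E * E * Real.exp (-δ * l1 (u' - u))) * ((E * Real.exp (-δ * l1 (x - u))) * (E * Real.exp (-δ * l1 (z - u)))) := by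
          refine mul_le_mul (mul_le_mul_of_nonneg_left r1 hC) hxz (mul_nonneg (Real.exp_pos _).le (Real.exp_pos _).le) ?_
          exact mul_nonneg hC (mul_nonneg (mul_nonneg (Real.exp_pos _).le (Real.exp_pos _).le) (Real.exp_pos _).le)
      _ = E * E * E * E * C * (Real.exp (-δ * l1 (u' - u)) * (Real.exp (-δ * l1 (x - u)) * Real.exp (-δ * l1 (z - u)))) := by ring
  have h1 := abs_defect_fst_snd_le hN hr Y κ u κ' u' x z a b
  show |((fun κ u κ' u' => coProjBmAtK (toSite r) N (fun κ₁ u₁ => ((fun κ u => coProjBmAtK (toSite r) N (Y κ u)) - Y) κ₁ u₁ κ' u') κ u)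
        - ((fun κ u => coProjBmAtK (toSite r) N (Y κ u)) - Y)) κ u κ' u' x z a b| ≤ _
  refine h1.trans ?_
  have hsum : ∑ v ∈ cube (d + 1) N, ∑ v' ∈ cube (d + 1) N, |divV (fun κ₂ u₂ => divV (fun κ₁ u₁ => Y κ₁ u₁ κ₂ u₂) (u + v)) (u' + v') x z a b|
      ≤ ∑ _v ∈ cube (d + 1) N, ∑ _v' ∈ cube (d + 1) N, E * E * E * E * C * (Real.exp (-δ * l1 (u' - u)) * Real.exp (-δ * (l1 (x - u) + l1 (z - u)))) :=
    Finset.sum_le_sum fun v hv => Finset.sum_le_sum fun v' hv' => hterm v hv v' hv'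
  calc (2 * ((d : ℝ) + 1) * N) ^ 2 * ∑ v ∈ cube (d + 1) N, ∑ v' ∈ cube (d + 1) N,
          |divV (fun κ₂ u₂ => divV (fun κ₁ u₁ => Y κ₁ u₁ κ₂ u₂) (u + v)) (u' + v') x z a b|
      ≤ (2 * ((d : ℝ) + 1) * N) ^ 2 * ∑ _v ∈ cube (d + 1) N, ∑ _v' ∈ cube (d + 1) N,
          E * E * E * E * C * (Real.exp (-δ * l1 (u' - u)) * Real.exp (-δ * (l1 (x - u) + l1 (z - u)))) :=
        mul_le_mul_of_nonneg_left hsum (pow_nonneg (two_mul_nonneg d N) 2)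
    _ = _ := by rw [sum_cube_const, sum_cube_const, hE4]; ring

end FstSnd

/-! ## §5 The three pure-source terms of T-DL together -/

section Source

variable {N : ℕ} {r : Fin (d + 1) → ℕ}

/-- [folklore] Sum of three `LocStencil₂` tables at a common rate (constants add; pointwise `+` of the tables). -/
theorem locStencil₂_add₃ {A B E : Tab d} {CA CB CE δ : ℝ} (hA : LocStencil₂ A CA δ) (hB : LocStencil₂ B CB δ) (hE : LocStencil₂ E CE δ) :
    LocStencil₂ (A + B + E) (CA + CB + CE) δ := by
  intro κ u κ' u' x z a b
  have h1 := hA κ u κ' u' x z a b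
  have h2 := hB κ u κ' u' x z a b
  have h3 := hE κ u κ' u' x z a b
  show |A κ u κ' u' x z a b + B κ u κ' u' x z a b + E κ u κ' u' x z a b| ≤ _
  rw [add_mul, add_mul, add_mul, add_mul]
  exact (abs_add_three _ _ _).trans (add_le_add (add_le_add h1 h2) h3)

/-- NOT IN PRINT; OUR BOOKKEEPING.  **THE `S ⊆ {1,2}` PART OF ROW (Q-D) FROM THE THREE DIVERGENCE LETTERS** (in-block root, `1 ≤ N`, `0 ≤ δ`): if the second-slot, first-slot and
double slot divergences of `Y` carry the letters of §3, §2, §4 with constants `C₂`, `C₁`, `C₁₂` at one rate `δ`, then the sum of the three pure-source terms of leaf-06's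
T-DL `tableDress_sub_self_eq_fifteen` — `D_{2} Y + D_{1} Y + D_{2,1} Y` — is `LocStencil₂` at rate `δ` with constant
`2(d+1)N·(2N+1)^{d+1}·e^{δ(d+1)N}·C₂ + 2(d+1)N·(2N+1)^{d+1}·e^{3δ(d+1)N}·C₁ + (2(d+1)N)²·(2N+1)^{2(d+1)}·e^{4δ(d+1)N}·C₁₂`.  The letters are HYPOTHESES (SLAVE-src ∘
(Q-S)∕(Q-R) is to deliver them for `Y = T̃_j` uniformly in `j`); the twelve leg-touching terms of T-DL are (Q-L), not here. -/
theorem locStencil₂_sourceDefects_of_div (hN : 1 ≤ N) (hr : r ∈ box (d + 1) N) (Y : Tab d) {C₁ C₂ C₁₂ δ : ℝ} (hδ : 0 ≤ δ)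
    (hW₂ : ∀ (κ : Fin (d + 1)) (u p x z : Fin (d + 1) → ℤ) (a b : Fib d),
      |divV (fun κ₁ u₁ => Y κ u κ₁ u₁) p x z a b| ≤ C₂ * Real.exp (-δ * l1 (p - u)) * Real.exp (-δ * (l1 (x - u) + l1 (z - u))))
    (hW₁ : ∀ (p : Fin (d + 1) → ℤ) (κ' : Fin (d + 1)) (u' x z : Fin (d + 1) → ℤ) (a b : Fib d),
      |divV (fun κ₁ u₁ => Y κ₁ u₁ κ' u') p x z a b| ≤ C₁ * Real.exp (-δ * l1 (u' - p)) * Real.exp (-δ * (l1 (x - p) + l1 (z - p))))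
    (hW₁₂ : ∀ (p p' x z : Fin (d + 1) → ℤ) (a b : Fib d),
      |divV (fun κ₂ u₂ => divV (fun κ₁ u₁ => Y κ₁ u₁ κ₂ u₂) p) p' x z a b| ≤ C₁₂ * Real.exp (-δ * l1 (p' - p)) * Real.exp (-δ * (l1 (x - p) + l1 (z - p)))) :
    LocStencil₂
      ( ((fun κ u => coProjBmAtK (toSite r) N (Y κ u)) - Y)
      + ((fun κ u κ' u' => coProjBmAtK (toSite r) N (fun κ₁ u₁ => Y κ₁ u₁ κ' u') κ u) - Y)
      + ((fun κ u κ' u' => coProjBmAtK (toSite r) N (fun κ₁ u₁ => ((fun κ u => coProjBmAtK (toSite r) N (Y κ u)) - Y) κ₁ u₁ κ' u') κ u)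
          - ((fun κ u => coProjBmAtK (toSite r) N (Y κ u)) - Y)) )
      ( 2 * ((d : ℝ) + 1) * N * ((((2 * N + 1) ^ (d + 1) : ℕ) : ℝ) * (Real.exp (δ * (((d : ℝ) + 1) * N)) * C₂))
      + 2 * ((d : ℝ) + 1) * N * ((((2 * N + 1) ^ (d + 1) : ℕ) : ℝ) * (Real.exp (3 * δ * (((d : ℝ) + 1) * N)) * C₁))
      + (2 * ((d : ℝ) + 1) * N) ^ 2 * ((((2 * N + 1) ^ (d + 1) : ℕ) : ℝ) * ((((2 * N + 1) ^ (d + 1) : ℕ) : ℝ)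
          * (Real.exp (4 * δ * (((d : ℝ) + 1) * N)) * C₁₂))) ) δ :=
  locStencil₂_add₃ (locStencil₂_coProj_snd_sub_self_of_div hN hr Y hδ hW₂) (locStencil₂_coProj_fst_sub_self_of_div hN hr Y hδ hW₁)
    (locStencil₂_defect_fst_snd_of_div₂ hN hr Y hδ hW₁₂)

end Source

/-! ## §6 Docking with (Q-R)'s output convention: legs centred at the remaining slot, separate label rate -/

section Recenter

variable {N : ℕ} {r : Fin (d + 1) → ℕ}

/-- [folklore] **RE-CENTRING A TWO-RATE, OUTPUT-CENTRED FIRST-SLOT LETTER AT THE DIVERGENCE SITE**: if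
`|(divV (κ₁ u₁ ↦ Y κ₁ u₁ κ′ u′) p) x z a b| ≤ C·e^{−δ′|u′ − p|₁}·e^{−δ(|x − u′|₁ + |z − u′|₁)}` for all entries, then for every `δ₀` with `0 ≤ δ₀ ≤ δ` and `3δ₀ ≤ δ′`
the site-centred letter of §2 holds at rate `δ₀` with the same constant (`|x − p|₁ ≤ |x − u′|₁ + |u′ − p|₁`, twice; the label rate pays the two transfers). -/
theorem letter_fst_recenter (Y : Tab d) {C δ δ' δ₀ : ℝ} (hδ₀ : 0 ≤ δ₀) (hδ₀δ : δ₀ ≤ δ) (h3 : 3 * δ₀ ≤ δ')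
    (hW : ∀ (p : Fin (d + 1) → ℤ) (κ' : Fin (d + 1)) (u' x z : Fin (d + 1) → ℤ) (a b : Fib d),
      |divV (fun κ₁ u₁ => Y κ₁ u₁ κ' u') p x z a b| ≤ C * Real.exp (-δ' * l1 (u' - p)) * Real.exp (-δ * (l1 (x - u') + l1 (z - u')))) :
    ∀ (p : Fin (d + 1) → ℤ) (κ' : Fin (d + 1)) (u' x z : Fin (d + 1) → ℤ) (a b : Fib d),
      |divV (fun κ₁ u₁ => Y κ₁ u₁ κ' u') p x z a b| ≤ C * Real.exp (-δ₀ * l1 (u' - p)) * Real.exp (-δ₀ * (l1 (x - p) + l1 (z - p))) := by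
  have hC : 0 ≤ C := by
    have h := hW 0 0 0 0 0 (Sum.inl 0) (Sum.inl 0)
    have hpos : 0 < Real.exp (-δ' * l1 ((0 : Fin (d + 1) → ℤ) - 0)) * Real.exp (-δ * (l1 ((0 : Fin (d + 1) → ℤ) - 0) + l1 ((0 : Fin (d + 1) → ℤ) - 0))) :=
      mul_pos (Real.exp_pos _) (Real.exp_pos _)
    have h' : 0 ≤ C * (Real.exp (-δ' * l1 ((0 : Fin (d + 1) → ℤ) - 0)) * Real.exp (-δ * (l1 ((0 : Fin (d + 1) → ℤ) - 0) + l1 ((0 : Fin (d + 1) → ℤ) - 0)))) := by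
      rw [← mul_assoc]; exact (abs_nonneg _).trans h
    exact nonneg_of_mul_nonneg_left h' hpos
  intro p κ' u' x z a b
  have h := hW p κ' u' x z a b
  have tx : l1 (x - p) ≤ l1 (x - u') + l1 (u' - p) := l1_sub_triangle x u' p
  have tz : l1 (z - p) ≤ l1 (z - u') + l1 (u' - p) := l1_sub_triangle z u' p
  have ha : 0 ≤ l1 (u' - p) := l1_nonneg _
  have hb : 0 ≤ l1 (x - u') := l1_nonneg _
  have hc : 0 ≤ l1 (z - u') := l1_nonneg _
  refine h.trans ?_
  rw [mul_assoc, mul_assoc, ← Real.exp_add, ← Real.exp_add]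
  refine mul_le_mul_of_nonneg_left (Real.exp_le_exp.2 ?_) hC
  nlinarith

/-- NOT IN PRINT; OUR BOOKKEEPING.  **THE FIRST-SLOT DEFECT IS `LocStencil₂` FROM THE OUTPUT-CENTRED, TWO-RATE LETTER** (the shape (SLAVE) ∘ (Q-R) delivers per the row
owner's `QR-DESIGN-v0.md` §0; in-block root, `1 ≤ N`): for `0 ≤ δ₀ ≤ δ`, `3δ₀ ≤ δ′`,
`LocStencil₂ (P₁ Y − Y) (2(d+1)N · (2N+1)^{d+1} · e^{3δ₀(d+1)N} · C) δ₀` — `letter_fst_recenter` ⨾ §2. -/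
theorem locStencil₂_coProj_fst_sub_self_of_div' (hN : 1 ≤ N) (hr : r ∈ box (d + 1) N) (Y : Tab d) {C δ δ' δ₀ : ℝ} (hδ₀ : 0 ≤ δ₀) (hδ₀δ : δ₀ ≤ δ)
    (h3 : 3 * δ₀ ≤ δ')
    (hW : ∀ (p : Fin (d + 1) → ℤ) (κ' : Fin (d + 1)) (u' x z : Fin (d + 1) → ℤ) (a b : Fib d),
      |divV (fun κ₁ u₁ => Y κ₁ u₁ κ' u') p x z a b| ≤ C * Real.exp (-δ' * l1 (u' - p)) * Real.exp (-δ * (l1 (x - u') + l1 (z - u')))) :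
    LocStencil₂ ((fun κ u κ' u' => coProjBmAtK (toSite r) N (fun κ₁ u₁ => Y κ₁ u₁ κ' u') κ u) - Y)
      (2 * ((d : ℝ) + 1) * N * ((((2 * N + 1) ^ (d + 1) : ℕ) : ℝ) * (Real.exp (3 * δ₀ * (((d : ℝ) + 1) * N)) * C))) δ₀ :=
  locStencil₂_coProj_fst_sub_self_of_div hN hr Y hδ₀ (letter_fst_recenter Y hδ₀ hδ₀δ h3 hW)

end Recenter

end Summit.QuantumFields.BalabanUV.Beta.GAN24.SlotDefectWindowShapes

end
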